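import Summits.CriticalPhenomena.PercolationContinuityZ3.Theorems.PercNearOneGluingNoHeavyQuantLightResidDECFree
import Summits.CriticalPhenomena.PercolationContinuityZ3.Theorems.PercNearOneGluingNoHeavyQuantGluedForestSDEC
import HarnessLib

/-!
# QUANT lane R8, T-DEC: THE LAYER-FREE LIGHT NODE `LightResidDECFree` IS FALSE ON TREE-OK FORESTS — weak duality for `DECFree` and one exact
# dual certificate for the glued giant `R²[½](R⁹[.99])` beside two `R¹[.9](R¹[⅝])` at `a = .99` (census-1 gen 24, FINDING 3; the kernel form
# of prim-quant-arm-1 g50's numerical refutation, kit j255677, asked for in INBOX l.1801)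

builds on p205010 (kernel theorem, internal audit signed; external expert review pending)

Support file (`--supports stmt-CriticalPhenomena-4575`), QUANT lane seat prim-quant-census-1 (gen 24); memo
`run/shared/lean/prim/quant/prim-quant-census-1/RESID-DEC-G24.md` §12.  Theorems only, standard axioms, no sorries.  Uses this seat's `DECFree` /
`FreeValid` (`…QuantResidualDECFree`), arm-1 g50's `LightResidDECFreeOn` / `@[conjecture] LightResidDECFree` (`…QuantLightResidDECFree`) and arm-1 g49's
`gluedSib` (`…QuantGluedForestSDEC`).

WEAK DUALITY (`not_decFree_of_dual`): if a price `ψ : ℕ → ℝ` is nonnegative on every layer-free valid component — `0 ≤ g·ψ hi + (1−g)·ψ lo` whenever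
`lo ≤ hi ≤ M`, `0 ≤ g ≤ 1`, `FreeValid y T lo hi g` — and `Σ_{h ≤ M} ψ h·μ h < 0`, then `¬ DECFree y T M μ` (a mixture of components has `Σ ψ·μ =
Σ λ_r·(g_r ψ hi_r + (1−g_r) ψ lo_r) ≥ 0`).

THE INSTANCE (arm-1 g50's smallest "per-layer-only" giant, kit j255677, in glued form; census-1 `code/giant*.py`, `code/farkas.py`): `x = 49/100`,
`L = [C, C, G]`, `C = gluedSib 1 1 (9/10) (5/8) (⅝·196/225) = R¹[.9](R¹[⅝])`, `G = gluedSib 2 9 (1/2) (99/100) (.99·98/99) = R²[½](R⁹[.99])` — ALL THREE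
TREE-OK at `x` (`SibFam₃`), `a = 99/100`: `ftop 15`, `fmean 419/50`, `T = 41481/5000 ≈ 8.296`, capped floor `y = min (a x) ½ = 4851/10000`, weight
`wco = (100/109)² = 10000/11881`; the residual charges `{0,…,6, 12,…,15}` (the lone-giant pattern `{11}` has weight `0`).  PRICE: `ψ = −13/10` at `0`,
`−1` on the lows `1..4`, `(1−y)/y = 5149/4851` on `5, 6, 12..15`, `2` on the uncharged `7..11`.  Every `FreeValid` component is priced `≥ 0` (`120`
pairs + `16` singles, `interval_cases` + `linarith`; tight at the giant-gate pairs `{l, h; y}`, `l ∈ 1..4`, `h ≥ 12`, and nearly at `{0, 15; T/15}`),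
while `Σ ψ·R = −65257/93100000 < 0` (`Σ ψ·flaw L = 120457/3920000`, `Σ ψ·flaw Lₐ = 81655071523/3.92·10¹²`, computed in the kernel from the nested
`lconv`).  Hence `¬ DECFree y T 15 R`, i.e. **`¬ LightResidDECFree`**; census-1's and arm-1's exact per-layer LPs find the same residual DEC at EVERY
layer (the per-layer node `LightResidDEC` stands: 0 failures on ≈ 8.4·10⁵ + 3·10⁵ exact pairs).  MECHANISM (arm-1 §6(c)): the far giant atoms
`12..15` are the only absorbers of the lows `1..4`; per layer they are either cheap giants (gate `y`) or few lows are active; layer-free, every low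
pays the giant rate `y/(1−y)` at once and the zero atom's partner `{0, 15}` needs `T/15 > y` — total demand exceeds the far mass by `7·10⁻⁴`.

* `sum_psi_TP` (pricing one component), **`not_decFree_of_dual`** (weak duality);
* `sumψ_flaw_CCG`, `sumψ_flaw_CCG_scaled` (the two kernel evaluations), `freeRefutation_treeOK_C/_G`;
* **`not_lightResidDECFree : ¬ LightResidDECFree`**.

HONEST STATUS: refutes the LAYER-FREE light node only; `LightResidDEC`, `ResidDEC`, `SiblingStep`, `GateStepN`, `FarTreeRow` OPEN and untouched;
RATE class log\* / honest sentence of `run/shared/lean/prim/quant/README.md` unchanged.  [this work]; the instance family and its numerical refutation: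
prim-quant-arm-1 g50 (kit j255677); glued siblings: prim-quant-arm-1 g49.  Nothing here is cited as a published result.  The gluing rows served
[cite: KozmaNitzan2024, Conjecture 3 (p. 15)]; product measure [cite: Grimmett1999, §1.3 p. 10].
-/

noncomputable section

open scoped BigOperators

namespace Summit.CriticalPhenomena.PercolationContinuityZ3.Theorems
namespace Quant

open Finset

/-- the two-point law `{lo, hi; g}` -/
local notation3 "TP[" lo ", " hi ", " g ", " h "]" =>
  (g : ℝ) * (if (h : ℕ) = (hi : ℕ) then (1 : ℝ) else 0) + (1 - (g : ℝ)) * (if (h : ℕ) = (lo : ℕ) then (1 : ℝ) else 0)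

/-- the point mass `δ_K` -/
local notation3 "δ[" K "]" => (fun k : ℕ => if k = (K : ℕ) then (1 : ℝ) else 0)

/-- the dual price of the instance: `−13/10` at `0`, `−1` on `1..4`, `5149/4851 = (1−y)/y` on `5,6` and `12..15`, `2` on `7..11` -/
local notation3 "ψ♯" => (fun h : ℕ => if h = 0 then (-13 / 10 : ℝ) else if h ≤ 4 then -1 else if h ≤ 6 then 5149 / 4851
    else if h ≤ 11 then 2 else 5149 / 4851)

namespace LawDec

/-! ### Weak duality for the layer-free certificate -/

/-- pricing one two-point component: `Σ_{h ≤ M} ψ h·{lo,hi;g}(h) = g·ψ hi + (1−g)·ψ lo` (`lo, hi ≤ M`). [this work] -/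
theorem sum_psi_TP (ψ : ℕ → ℝ) (M lo hi : ℕ) (g : ℝ) (hlo : lo ≤ M) (hhi : hi ≤ M) :
    ∑ h ∈ Finset.range (M + 1), ψ h * TP[lo, hi, g, h] = g * ψ hi + (1 - g) * ψ lo := by
  have e : ∀ h, ψ h * TP[lo, hi, g, h] = (if h = hi then g * ψ hi else 0) + (if h = lo then (1 - g) * ψ lo else 0) := by
    intro h
    by_cases h1 : h = hi
    · by_cases h2 : h = lo
      · rw [if_pos h1, if_pos h2, if_pos h1, if_pos h2]; subst h1; subst h2; ring
      · rw [if_pos h1, if_neg h2, if_pos h1, if_neg h2]; subst h1; ring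
    · by_cases h2 : h = lo
      · rw [if_neg h1, if_pos h2, if_neg h1, if_pos h2]; subst h2; ring
      · rw [if_neg h1, if_neg h2, if_neg h1, if_neg h2]; ring
  rw [Finset.sum_congr rfl fun h _ => e h, Finset.sum_add_distrib, Finset.sum_ite_eq' (Finset.range (M + 1)) hi,
    Finset.sum_ite_eq' (Finset.range (M + 1)) lo, if_pos (Finset.mem_range.2 (by omega)), if_pos (Finset.mem_range.2 (by omega))]

/-- **WEAK DUALITY FOR `DECFree`**: a price nonnegative on every layer-free valid component and negative on `μ` refutes `DECFree y T M μ`. [this work] -/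
theorem not_decFree_of_dual (y T : ℝ) (M : ℕ) (μ ψ : ℕ → ℝ)
    (hval : ∀ (lo hi : ℕ) (g : ℝ), lo ≤ hi → hi ≤ M → 0 ≤ g → g ≤ 1 → FreeValid y T lo hi g → 0 ≤ g * ψ hi + (1 - g) * ψ lo)
    (hneg : ∑ h ∈ Finset.range (M + 1), ψ h * μ h < 0) : ¬ DECFree y T M μ := by
  classical
  rintro ⟨ρ, _, lam, g, lo, hi, h0, h1, hg, hlohi, hhi, hμ, hv⟩
  have hS : ∑ h ∈ Finset.range (M + 1), ψ h * μ h = ∑ r, lam r * (g r * ψ (hi r) + (1 - g r) * ψ (lo r)) := by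
    have e : ∀ h, ψ h * μ h = ∑ r, lam r * (ψ h * TP[lo r, hi r, g r, h]) := by
      intro h; rw [hμ h, Finset.mul_sum]; refine Finset.sum_congr rfl fun r _ => ?_; ring
    rw [Finset.sum_congr rfl fun h _ => e h, Finset.sum_comm]
    refine Finset.sum_congr rfl fun r _ => ?_
    rw [← Finset.mul_sum, sum_psi_TP ψ M (lo r) (hi r) (g r) ((hlohi r).trans (hhi r)) (hhi r)]
  have hpos : 0 ≤ ∑ r, lam r * (g r * ψ (hi r) + (1 - g r) * ψ (lo r)) := by
    refine Finset.sum_nonneg fun r _ => ?_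
    rcases eq_or_lt_of_le (h0 r) with hz | hp
    · rw [← hz, zero_mul]
    · exact mul_nonneg (h0 r) (hval _ _ _ (hlohi r) (hhi r) (hg r).1 (hg r).2 (hv r hp))
  linarith

/-! ### The instance: kernel evaluations of the priced forest laws -/

/-- `Σ_{h<16} ψ♯ h · flaw [C, C, G] h = 120457/3920000` for `C = R¹[9/10](R¹[⅝])`, `G = R²[½](R⁹[99/100])` (any recorded sub-floors). [this work] -/
theorem sumψ_flaw_CCG (x₁ x₁' : ℝ) :
    ∑ h ∈ Finset.range 16, ψ♯ h * flaw [gluedSib 1 1 (9 / 10) (5 / 8) x₁, gluedSib 1 1 (9 / 10) (5 / 8) x₁, gluedSib 2 9 (1 / 2) (99 / 100) x₁'] h =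
      120457 / 3920000 := by
  have vG : ∀ h, gate (slice δ[2] 9 (99 / 100)) (1 / 2) h =
      1 / 2 * ((if h = 2 then 1 - 99 / 100 else 0) + (if h = 2 + 9 then (99 / 100 : ℝ) else 0)) + (1 - 1 / 2) * (if h = 0 then (1 : ℝ) else 0) :=
    fun h => by rw [gate_apply, gluedSib_rho_apply 2 9 (by norm_num) (by norm_num)]
  have vC : ∀ h, gate (slice δ[1] 1 (5 / 8)) (9 / 10) h =
      9 / 10 * ((if h = 1 then 1 - 5 / 8 else 0) + (if h = 1 + 1 then (5 / 8 : ℝ) else 0)) + (1 - 9 / 10) * (if h = 0 then (1 : ℝ) else 0) :=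
    fun h => by rw [gate_apply, gluedSib_rho_apply 1 1 le_rfl le_rfl]
  have e1 : lconv 0 11 δ[0] (gate (slice δ[2] 9 (99 / 100)) (1 / 2)) = gate (slice δ[2] 9 (99 / 100)) (1 / 2) := by
    funext k
    refine lconv_delta_left 0 11 _ (fun i hi => ?_) k
    rw [vG i, if_neg (by omega), if_neg (by omega), if_neg (by omega)]
    ring
  show ∑ h ∈ Finset.range 16, ψ♯ h * lconv 13 2 (lconv 11 2 (lconv 0 11 δ[0] (gate (slice δ[2] 9 (99 / 100)) (1 / 2)))
      (gate (slice δ[1] 1 (5 / 8)) (9 / 10))) (gate (slice δ[1] 1 (5 / 8)) (9 / 10)) h = 120457 / 3920000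
  rw [e1]
  simp only [Finset.sum_range_succ, Finset.sum_range_zero, lconv, vG, vC]
  norm_num

/-- the same for the root-scaled list (`a = 99/100`): `Σ_{h<16} ψ♯ h · flaw [Cₐ, Cₐ, Gₐ] h = 81655071523/3920000000000`. [this work] -/
theorem sumψ_flaw_CCG_scaled (x₁ x₁' : ℝ) :
    ∑ h ∈ Finset.range 16, ψ♯ h * flaw [gluedSib 1 1 (99 / 100 * (9 / 10)) (5 / 8) x₁, gluedSib 1 1 (99 / 100 * (9 / 10)) (5 / 8) x₁,
      gluedSib 2 9 (99 / 100 * (1 / 2)) (99 / 100) x₁'] h = 81655071523 / 3920000000000 := by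
  have vG : ∀ h, gate (slice δ[2] 9 (99 / 100)) (99 / 100 * (1 / 2)) h =
      99 / 100 * (1 / 2) * ((if h = 2 then 1 - 99 / 100 else 0) + (if h = 2 + 9 then (99 / 100 : ℝ) else 0)) +
        (1 - 99 / 100 * (1 / 2)) * (if h = 0 then (1 : ℝ) else 0) :=
    fun h => by rw [gate_apply, gluedSib_rho_apply 2 9 (by norm_num) (by norm_num)]
  have vC : ∀ h, gate (slice δ[1] 1 (5 / 8)) (99 / 100 * (9 / 10)) h =
      99 / 100 * (9 / 10) * ((if h = 1 then 1 - 5 / 8 else 0) + (if h = 1 + 1 then (5 / 8 : ℝ) else 0)) +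
        (1 - 99 / 100 * (9 / 10)) * (if h = 0 then (1 : ℝ) else 0) :=
    fun h => by rw [gate_apply, gluedSib_rho_apply 1 1 le_rfl le_rfl]
  have e1 : lconv 0 11 δ[0] (gate (slice δ[2] 9 (99 / 100)) (99 / 100 * (1 / 2))) = gate (slice δ[2] 9 (99 / 100)) (99 / 100 * (1 / 2)) := by
    funext k
    refine lconv_delta_left 0 11 _ (fun i hi => ?_) k
    rw [vG i, if_neg (by omega), if_neg (by omega), if_neg (by omega)]
    ring
  show ∑ h ∈ Finset.range 16, ψ♯ h * lconv 13 2 (lconv 11 2 (lconv 0 11 δ[0] (gate (slice δ[2] 9 (99 / 100)) (99 / 100 * (1 / 2))))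
      (gate (slice δ[1] 1 (5 / 8)) (99 / 100 * (9 / 10)))) (gate (slice δ[1] 1 (5 / 8)) (99 / 100 * (9 / 10))) h = 81655071523 / 3920000000000
  rw [e1]
  simp only [Finset.sum_range_succ, Finset.sum_range_zero, lconv, vG, vC]
  norm_num

/-- the companion `C = R¹[9/10](R¹[⅝])` recorded at `⅝·(196/225) = 49/90` is tree-OK at the floor `49/100`. [this work] -/
theorem freeRefutation_treeOK_C : (gluedSib 1 1 (9 / 10) (5 / 8) (5 / 8 * (196 / 225))).TreeOK (49 / 100) :=
  gluedSib_treeOK 1 1 le_rfl le_rfl (by norm_num) (by norm_num) (by norm_num) (by norm_num) (by norm_num) (by norm_num) (by norm_num)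

/-- the giant `G = R²[½](R⁹[99/100])` recorded at `(99/100)·(98/99) = 49/50` is tree-OK at the floor `49/100`. [this work] -/
theorem freeRefutation_treeOK_G : (gluedSib 2 9 (1 / 2) (99 / 100) (99 / 100 * (98 / 99))).TreeOK (49 / 100) :=
  gluedSib_treeOK 2 9 (by norm_num) (by norm_num) (by norm_num) (by norm_num) (by norm_num) (by norm_num) (by norm_num) (by norm_num)
    (by norm_num)

/-! ### The price is nonnegative on every layer-free valid component -/

/-- the price is nonnegative from `5` on. [this work] -/
theorem freeRefutation_price_nonneg (h : ℕ) (hh : 5 ≤ h) : (0 : ℝ) ≤ ψ♯ h := by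
  simp only
  rw [if_neg (by omega), if_neg (by omega)]
  split_ifs <;> norm_num

/-- **every `FreeValid (4851/10000) (41481/5000)` component on `{0..15}` is priced `≥ 0` by `ψ♯`** (floor and target written as the main theorem
produces them).  Cases: `lo ≥ 5` (both prices `≥ 0`); `lo ≤ 4 < 5 ≤ hi` (the giant rate: `g ≥ y`, and for `lo = 0` the credit `15·g ≥ hi·g ≥ T`);
`hi ≤ 4` is impossible (`credit ≤ lo + hi ≤ 8 < T`); singles need `2·lo ≥ T`, i.e. `lo ≥ 5`. [this work] -/
theorem freeRefutation_price_valid (lo hi : ℕ) (g : ℝ) (hlohi : lo ≤ hi) (hhi : hi ≤ 15) (hg0 : 0 ≤ g) (hg1 : g ≤ 1)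
    (hfv : FreeValid (min (99 / 100 * (49 / 100)) (1 / 2)) (99 / 100 * (419 / 50)) lo hi g) : 0 ≤ g * ψ♯ hi + (1 - g) * ψ♯ lo := by
  rw [min_eq_left (by norm_num)] at hfv
  rcases hfv with ⟨heq, h2⟩ | ⟨hlt, hyg, hcr⟩
  · -- a single: `T ≤ 2·lo` forces `lo ≥ 5`
    subst heq
    have h5 : 5 ≤ lo := by
      by_contra hc
      have : (lo : ℝ) ≤ 4 := by exact_mod_cast (by omega : lo ≤ 4)
      linarith
    have e : g * ψ♯ lo + (1 - g) * ψ♯ lo = ψ♯ lo := by ring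
    rw [e]
    exact freeRefutation_price_nonneg lo h5
  · rcases Nat.lt_or_ge lo 5 with hlo5 | hlo5
    swap
    · -- both ends priced `≥ 0`
      exact add_nonneg (mul_nonneg hg0 (freeRefutation_price_nonneg hi (by omega)))
        (mul_nonneg (by linarith) (freeRefutation_price_nonneg lo hlo5))
    · rcases Nat.lt_or_ge 4 hi with hhi4 | hhi4
      swap
      · -- impossible: credit ≤ lo + hi ≤ 8 < T
        exfalso
        have hc1 : ((hi : ℝ) - lo) * g ≤ (hi : ℝ) - lo :=
          mul_le_of_le_one_right (sub_nonneg.2 (by exact_mod_cast hlt.le)) hg1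
        have hlo4 : (lo : ℝ) ≤ 4 := by exact_mod_cast (by omega : lo ≤ 4)
        have hhi4' : (hi : ℝ) ≤ 4 := by exact_mod_cast hhi4
        linarith
      · -- the price of `hi ≥ 5`: `5149/4851` or `2`
        have hψhi : ψ♯ hi = 5149 / 4851 ∨ ψ♯ hi = 2 := by
          simp only
          rw [if_neg (by omega), if_neg (by omega)]
          split_ifs
          · exact Or.inl rfl
          · exact Or.inr rfl
          · exact Or.inl rfl
        have hhi15 : (hi : ℝ) ≤ 15 := by exact_mod_cast hhi
        rcases Nat.eq_zero_or_pos lo with hl0 | hlpos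
        · -- `lo = 0`: price `−13/10`; the credit gives `15·g ≥ hi·g ≥ T`
          subst hl0
          have hψ0 : ψ♯ 0 = -13 / 10 := by simp
          have hg15 : (41481 / 5000 : ℝ) ≤ 15 * g := by
            have h15 : (hi : ℝ) * g ≤ 15 * g := mul_le_mul_of_nonneg_right hhi15 hg0
            norm_num at hcr
            linarith
          rw [hψ0]
          rcases hψhi with e | e <;> rw [e] <;> nlinarith
        · -- `1 ≤ lo ≤ 4`: price `−1`; the giant rate `g ≥ y` suffices
          have hψlo : ψ♯ lo = -1 := by
            simp only
            rw [if_neg (by omega), if_pos (by omega)]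
          rw [hψlo]
          rcases hψhi with e | e <;> rw [e] <;> nlinarith

/-! ### The refutation -/

/-- **THE LAYER-FREE LIGHT NODE IS FALSE: `¬ LightResidDECFree`.**  At `x = 49/100`, `L = [C, C, G]` (tree-OK glued siblings as in the file header),
`a = 99/100`: the residual `resid a (wco a L) L` (capped floor `4851/10000`, target `41481/5000`, top `15`) is NOT `DECFree`, by weak duality with
the price `ψ♯` — every `FreeValid` component is priced `≥ 0` and `Σ ψ♯·resid = −65257/93100000`.  The per-layer node `LightResidDEC` holds for this
residual at every layer (exact LPs, census-1 / arm-1). [this work] -/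
theorem not_lightResidDECFree : ¬ LightResidDECFree := by
  intro hfree
  set C : Sib := gluedSib 1 1 (9 / 10) (5 / 8) (5 / 8 * (196 / 225)) with hCdef
  set G : Sib := gluedSib 2 9 (1 / 2) (99 / 100) (99 / 100 * (98 / 99)) with hGdef
  set L : List Sib := [C, C, G] with hLdef
  have hCT : C.TreeOK (49 / 100) := by rw [hCdef]; exact freeRefutation_treeOK_C
  have hGT : G.TreeOK (49 / 100) := by rw [hGdef]; exact freeRefutation_treeOK_G
  have hLT : ∀ s ∈ L, s.TreeOK (49 / 100) := by
    intro s hs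
    rw [hLdef] at hs
    simp only [List.mem_cons, List.mem_nil_iff, or_false] at hs
    rcases hs with h | h | h
    · rw [h]; exact hCT
    · rw [h]; exact hCT
    · rw [h]; exact hGT
  have hL : ∀ s ∈ L, s.LawOK := fun s hs => (hLT s hs).lawOK
  have hfam : SibFam₃ (49 / 100) L := ⟨hLT, by rw [hLdef]; simp⟩
  have hd := hfree (49 / 100) L (by norm_num) (by norm_num) hfam (99 / 100) (by norm_num) (by norm_num)
  -- the data of the residual
  have hCmean : C.mean = 13 / 8 := by rw [hCdef, gluedSib_mean]; norm_num
  have hGmean : G.mean = 1091 / 100 := by rw [hGdef, gluedSib_mean]; norm_num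
  have htop : ftop L = 15 := by rw [hLdef, hCdef, hGdef]; rfl
  have hfmean : fmean L = 419 / 50 := by
    rw [hLdef]
    simp only [fmean]
    rw [hCmean, hGmean, hCdef, hGdef]
    show (0 : ℝ) + 1 / 2 * (1091 / 100) + 9 / 10 * (13 / 8) + 9 / 10 * (13 / 8) = 419 / 50
    norm_num
  have hw : wco (99 / 100) L = 10000 / 11881 := by
    rw [hLdef, hCdef, hGdef]
    simp only [wco, rprod, rfac, gluedSib]
    norm_num [min_def]
  rw [htop, hfmean, hw] at hd
  -- the priced sums
  have hSF : ∑ h ∈ Finset.range 16, ψ♯ h * flaw L h = 120457 / 3920000 := by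
    rw [hLdef, hCdef, hGdef]; exact sumψ_flaw_CCG _ _
  have hSFa : ∑ h ∈ Finset.range 16, ψ♯ h * flaw (L.map (Sib.scale (99 / 100))) h = 81655071523 / 3920000000000 := by
    have e : L.map (Sib.scale (99 / 100)) = [gluedSib 1 1 (99 / 100 * (9 / 10)) (5 / 8) (5 / 8 * (196 / 225)),
        gluedSib 1 1 (99 / 100 * (9 / 10)) (5 / 8) (5 / 8 * (196 / 225)), gluedSib 2 9 (99 / 100 * (1 / 2)) (99 / 100) (99 / 100 * (98 / 99))] := by
      rw [hLdef, hCdef, hGdef]; rfl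
    rw [e]; exact sumψ_flaw_CCG_scaled _ _
  have hSG : ∑ h ∈ Finset.range 16, ψ♯ h * gate (flaw L) (99 / 100) h = 99 / 100 * (120457 / 3920000) + (1 - 99 / 100) * (-13 / 10) := by
    have e : ∀ h, ψ♯ h * gate (flaw L) (99 / 100) h =
        99 / 100 * (ψ♯ h * flaw L h) + (if h = 0 then (1 - 99 / 100) * (-13 / 10 : ℝ) else 0) := by
      intro h
      rw [gate_apply]
      by_cases h0 : h = 0
      · subst h0; simp only [if_true]; norm_num; ring
      · rw [if_neg h0, if_neg h0]; ring
    rw [Finset.sum_congr rfl fun h _ => e h, Finset.sum_add_distrib, ← Finset.mul_sum, hSF, Finset.sum_ite_eq' (Finset.range 16) 0,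
      if_pos (by simp)]
  have hneg : ∑ h ∈ Finset.range (15 + 1), ψ♯ h * resid (99 / 100) (10000 / 11881) L h < 0 := by
    have e : ∀ h, ψ♯ h * resid (99 / 100) (10000 / 11881) L h =
        (ψ♯ h * gate (flaw L) (99 / 100) h - 10000 / 11881 * (ψ♯ h * flaw (L.map (Sib.scale (99 / 100))) h)) / (1 - 10000 / 11881) := by
      intro h
      show ψ♯ h * ((gate (flaw L) (99 / 100) h - 10000 / 11881 * flaw (L.map (Sib.scale (99 / 100))) h) / (1 - 10000 / 11881)) = _
      ring
    rw [show (15 + 1 : ℕ) = 16 from rfl, Finset.sum_congr rfl fun h _ => e h, ← Finset.sum_div, Finset.sum_sub_distrib, ← Finset.mul_sum,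
      hSG, hSFa]
    norm_num
  -- every layer-free valid component is priced nonnegatively: `freeRefutation_price_valid`
  exact not_decFree_of_dual _ _ 15 _ _ freeRefutation_price_valid hneg hd

end LawDec

end Quant

end Summit.CriticalPhenomena.PercolationContinuityZ3.Theorems
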